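import Summits.AnomalousDissipation.AnomalousDissipation.Theses.QuarticLadder

/-!
# Birth skeleton (BC3) for crux `QuarticLadder.MomentClosure`
# (stmt-AnomalousDissipation-15063, route `QuarticLadder`, binder 4 of `closes`)

Registered by the skeleton registrar (planner one-shot, route re-audit bin HONEST-BET, 2026-08-17).
Two NAMED stubs and the kernel-checked composition `MomentClosure_of` concluding the crux BY NAME
(`MomentClosure_of_stubs` plugs the registered stubs in). Imports ONLY the route file (module cone =
the route's own: no `Theorems.MomentParityMomentClosure*`, whose import chain the rev-3 cone repair of
the route removed on purpose).

## The crux (FIXED — `Summit.AnomalousDissipation.AnomalousDissipation.Theses.QuarticLadder.MomentClosure`)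

CLOSURE IN THE MOMENT ORDER `d` at fixed `(f, ν, N, E, ε, R, κ)`: if for EVERY `d` there is a
level-`N` Borel probability measure on `H = L²_σ(T³)`, supported in `‖u‖ ≤ R`, with `κ`-resolved
dissipation, `d`-stationary for Galerkin NS at `(ν, f)` (every polynomial cylindrical observable of
degree `≤ d - 1` in band-limited solenoidal test fields is drift-free), mean energy `≤ E` and
dissipation `≥ ε`, then ONE level-`N` probability measure with the same support ball, tail schedule and
budgets is Galerkin-INVARIANT: drift-free for every compactly supported `C¹` cylindrical test
functional `Φ` with band-limited fields. (Verbatim twin of `MomentParity.MomentClosure`, PROVED in tree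
as `Theorems.momentClosure_proof`; this row is the QuarticLadder duplicate — "provable-now", no truth
risk; the skeleton below is the honest two-piece anatomy of that proof, not a new bet.)

## The cut: weak-* closure of the POLYNOMIAL rows | `C¹` upgrade on the compact carrier

* STUB 1 `stub_polyStationaryLimit` (M/L) — WEAK-* CLOSURE IN `d` WITH POLYNOMIAL ROWS: under the
  hypotheses of the crux there is ONE level-`N` probability measure, supported in `‖u‖ ≤ R`, with the
  tail schedule `κ`, energy `≤ E`, dissipation `≥ ε`, which is `d`-stationary for EVERY `d` AT ONCE
  (all polynomial cylindrical observables, no degree bound). Mechanism: the carrier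
  `K = {u level-N, ‖u‖ ≤ R}` is compact (finite-dimensional ball), probability measures on `K` are
  weak-* sequentially compact (Prokhorov / Riesz), and every row — energy `∫‖u‖²`, the band enstrophies
  `4π² Σ_{|k| ≤ M} |k|²|û(k)|²` (continuous on `K`, so the `lintegral` tail clause and the dissipation
  floor are closed conditions), and each polynomial generator row `∫⟨F(u), ∇p(u)⟩ dμ_d = 0` (true as
  soon as `d > deg p`, integrand continuous) — is a CLOSED condition on the limit. Why it might fail:
  only clerically (the `lintegral`/`toReal` junk conventions of `ensembleDissipation` and of the tail
  clause must be converted to means of continuous band sums on `K`; done in tree for the twin).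
* STUB 2 `stub_cylindricalUpgrade` (M) — POLYNOMIAL ⟹ `C¹_c` CYLINDRICAL on a level ball: a level-`N`
  probability measure supported in `‖u‖ ≤ R` that annihilates the generator row of EVERY polynomial
  observable in band-limited smooth solenoidal mean-zero fields annihilates `∫⟨F(u), Φ'(u)⟩ dμ` for
  every `C¹_c` cylindrical `Φ` with band-limited fields (row integrable). Mechanism: Weierstrass
  approximation WITH FIRST DERIVATIVES of the profile `φ` on the compact coordinate image
  `coords(K) ⊆ ℝᵐ` (`Literature.Topology.FourManifolds.exists_mvPolynomial_close_C1`, in tree), and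
  `⟨F(u), Φ'(u)⟩ - ⟨F(u), ∇p(u)⟩ = Σᵢ (∂ᵢφ - ∂ᵢp)(coords u) ⟨F(u), gᵢ⟩` with `⟨F(u), gᵢ⟩` bounded on `K`.
  Why it might fail: it does not (Nachbin/Whitney `C¹` density of polynomials on compacta); size is in
  the bookkeeping of `CylindricalTest.grad` versus the polynomial differential.
* COMPOSITION `MomentClosure_of : Sig.stub_polyStationaryLimit → Sig.stub_cylindricalUpgrade →
  MomentClosure` — pure logic (3 lines): STUB 1 produces the measure with all clauses but the
  cylindrical one; STUB 2 converts its all-degree polynomial stationarity into cylindrical invariance.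

Why this cut and not another. It is the seam of the landed twin proof (`momentClosure_proof`: steps
1–3 = STUB 1, step 4 = STUB 2, there the named lemma `integral_nsGeneratorPairing_grad_eq_zero`), so both
stubs are provable now by instantiating tree mathematics; neither is bookkeeping (compactness + closed
rows, resp. `C¹`-Weierstrass), neither restates the crux (STUB 1 never mentions `CylindricalTest`,
STUB 2 has no sequence in `d` and no budgets) or the summit (no Leray–Hopf path, no `ν → 0`).
Signatures are INLINED clause shapes over Literature declarations only (no local vocabulary), so each
stub lands verbatim as a `Theorems/QuarticLadderMomentClosure….lean` file with `--supports`.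

## BC3 probes (registrar, 2026-08-17; `bc/probe_stub_polyStationaryLimit.lean`,
`bc/probe_stub_cylindricalUpgrade.lean`, `bc/probe_converse.lean` in the seat folder — vocabulary
copied VERBATIM into `…Cruxes.MomentClosure.BirthProbe[Converse]`, skeleton theorems NOT present)

For each `S ∈ {Sig.stub_polyStationaryLimit, Sig.stub_cylindricalUpgrade}` and each target
`T ∈ {QuarticLadder.MomentClosure, _root_.AnomalousDissipation}` (maxHeartbeats 400000 each):
the mandated `example : S → T := by first | exact? | simpa | aesop` FAILS 4/4 ("unsolved goals
a : S ⊢ MomentClosure" / "⊢ AnomalousDissipation", "aesop: failed to prove the goal after exhaustive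
search"); one closer at a time FAILS 12/12 ("`exact?` could not close the goal", simpa: "Tactic
`assumption` failed", aesop: exhaustive search failed); the unfolding closers `first | exact? |
simpa [S] | (unfold S; simpa) | aesop` and `intro h; simpa [S, T] using h` FAIL 8/8 (whnf / isDefEq
timeout at 400000 heartbeats, resp. "Type mismatch: After simplification" for STUB 2 → summit); the
converses `T → S` FAIL 4/4 (unsolved goals) and `example : S` by `exact? | (unfold S; aesop) | simp [S]`
FAILS 2/2 (whnf timeout, resp. unsolved `Integrable … ∧ ∫ … = 0`). Files rc 1 with 12 + 12 + 6 errors =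
number of examples. No stub is cheaply the crux or the summit, none is a cheap tautology.

Disproof used: none on file (`ledger crux ls stmt-AnomalousDissipation-15063`: no workfiles,
2026-08-17). Negatives honoured (`ledger negatives --problem AnomalousDissipation`, 6 entries:
ScalarLift2halfD, CorrelationEnergyUnboundedNeg, TaylorCertificatePair, GPEnergyCeiling,
EnsembleCeilingBridge, RobustDecayQuantum — none concerns level-`N` measure limits or test-class
upgrades): no stub re-words a refuted statement.
-/

-- the problem namespace `AnomalousDissipation.AnomalousDissipation` (single-conjunct summit) trips dupNamespace
set_option linter.dupNamespace false

noncomputable section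

open MeasureTheory Filter Topology UnitAddTorus
open scoped ENNReal
open Literature.Analysis.FunctionSpaces Literature.Analysis.FluidPDE

namespace Summit.AnomalousDissipation.AnomalousDissipation.Cruxes.MomentClosure.Birth

open Summit.AnomalousDissipation.AnomalousDissipation.Theses.QuarticLadder (MomentClosure)

/-! ### The stub SIGNATURES (`Sig.stub_<name>` = verbatim the statement of `theorem stub_<name>`) -/

/-- Signature of STUB 1: weak-* closure in the moment order with POLYNOMIAL rows of every degree. -/
def Sig.stub_polyStationaryLimit : Prop :=
  ∀ f : UnitAddTorus (Fin 3) → EuclideanSpace ℝ (Fin 3), Torus.IsSmooth f → Torus.IsDivFree f →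
    Torus.HasZeroMean f → ∀ (ν : ℝ) (N : ℕ) (E ε R : ℝ) (κ : ℕ → ℕ), 0 < ν →
    (∀ d : ℕ, ∃ μ : Measure (Torus.energySpace (Fin 3)), IsProbabilityMeasure μ ∧
      (∀ᵐ (u : Torus.energySpace (Fin 3)) ∂μ, (∀ k ∉ (Torus.freqBall N).erase (0 : Fin 3 → ℤ),
        mFourierCoeff (EuclideanSpace.complexify ∘ (u.1 : UnitAddTorus (Fin 3) → EuclideanSpace ℝ (Fin 3))) k = 0)) ∧
      (∀ᵐ u ∂μ, ‖u‖ ≤ R) ∧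
      (∀ n : ℕ, ∫⁻ (u : Torus.energySpace (Fin 3)), Torus.eGradNormSq (u.1 : UnitAddTorus (Fin 3) → EuclideanSpace ℝ (Fin 3)) ∂μ ≤
        (∫⁻ (u : Torus.energySpace (Fin 3)), Torus.eGradNormSq (Torus.fourierTruncate (κ n) (u.1 : UnitAddTorus (Fin 3) → EuclideanSpace ℝ (Fin 3))) ∂μ) +
          ((n : ENNReal) + 1)⁻¹) ∧
      (∀ (m : ℕ) (g : Fin m → UnitAddTorus (Fin 3) → EuclideanSpace ℝ (Fin 3)) (P : MvPolynomial (Fin m) ℝ),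
        (∀ i, (Torus.IsSmooth (g i) ∧ Torus.IsDivFree (g i) ∧ Torus.HasZeroMean (g i) ∧
          (∀ k ∉ (Torus.freqBall N).erase (0 : Fin 3 → ℤ), mFourierCoeff (EuclideanSpace.complexify ∘ (g i)) k = 0))) →
        P.totalDegree + 1 ≤ d →
        Integrable (fun u => Torus.nsGeneratorPairing ν f u (fun x => ∑ i : Fin m,
          (MvPolynomial.eval (fun j => Torus.pairing u.1 (g j)) (MvPolynomial.pderiv i P)) • g i x)) μ ∧
        ∫ u, Torus.nsGeneratorPairing ν f u (fun x => ∑ i : Fin m,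
          (MvPolynomial.eval (fun j => Torus.pairing u.1 (g j)) (MvPolynomial.pderiv i P)) • g i x) ∂μ = 0) ∧
      Torus.ensembleEnergy μ ≤ E ∧ ε ≤ Torus.ensembleDissipation ν μ) →
    ∃ μ : Measure (Torus.energySpace (Fin 3)), IsProbabilityMeasure μ ∧
      (∀ᵐ (u : Torus.energySpace (Fin 3)) ∂μ, (∀ k ∉ (Torus.freqBall N).erase (0 : Fin 3 → ℤ),
        mFourierCoeff (EuclideanSpace.complexify ∘ (u.1 : UnitAddTorus (Fin 3) → EuclideanSpace ℝ (Fin 3))) k = 0)) ∧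
      (∀ᵐ u ∂μ, ‖u‖ ≤ R) ∧
      (∀ n : ℕ, ∫⁻ (u : Torus.energySpace (Fin 3)), Torus.eGradNormSq (u.1 : UnitAddTorus (Fin 3) → EuclideanSpace ℝ (Fin 3)) ∂μ ≤
        (∫⁻ (u : Torus.energySpace (Fin 3)), Torus.eGradNormSq (Torus.fourierTruncate (κ n) (u.1 : UnitAddTorus (Fin 3) → EuclideanSpace ℝ (Fin 3))) ∂μ) +
          ((n : ENNReal) + 1)⁻¹) ∧
      (∀ (m : ℕ) (g : Fin m → UnitAddTorus (Fin 3) → EuclideanSpace ℝ (Fin 3)) (P : MvPolynomial (Fin m) ℝ),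
        (∀ i, (Torus.IsSmooth (g i) ∧ Torus.IsDivFree (g i) ∧ Torus.HasZeroMean (g i) ∧
          (∀ k ∉ (Torus.freqBall N).erase (0 : Fin 3 → ℤ), mFourierCoeff (EuclideanSpace.complexify ∘ (g i)) k = 0))) →
        Integrable (fun u => Torus.nsGeneratorPairing ν f u (fun x => ∑ i : Fin m,
          (MvPolynomial.eval (fun j => Torus.pairing u.1 (g j)) (MvPolynomial.pderiv i P)) • g i x)) μ ∧
        ∫ u, Torus.nsGeneratorPairing ν f u (fun x => ∑ i : Fin m,
          (MvPolynomial.eval (fun j => Torus.pairing u.1 (g j)) (MvPolynomial.pderiv i P)) • g i x) ∂μ = 0) ∧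
      Torus.ensembleEnergy μ ≤ E ∧ ε ≤ Torus.ensembleDissipation ν μ

/-- Signature of STUB 2: polynomial stationarity of every degree ⟹ `C¹_c` cylindrical invariance on a
level ball. -/
def Sig.stub_cylindricalUpgrade : Prop :=
  ∀ f : UnitAddTorus (Fin 3) → EuclideanSpace ℝ (Fin 3), Torus.IsSmooth f →
    ∀ (ν : ℝ) (N : ℕ) (R : ℝ) (μ : Measure (Torus.energySpace (Fin 3))), IsProbabilityMeasure μ →
    (∀ᵐ (u : Torus.energySpace (Fin 3)) ∂μ, (∀ k ∉ (Torus.freqBall N).erase (0 : Fin 3 → ℤ),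
      mFourierCoeff (EuclideanSpace.complexify ∘ (u.1 : UnitAddTorus (Fin 3) → EuclideanSpace ℝ (Fin 3))) k = 0)) →
    (∀ᵐ u ∂μ, ‖u‖ ≤ R) →
    (∀ (m : ℕ) (g : Fin m → UnitAddTorus (Fin 3) → EuclideanSpace ℝ (Fin 3)) (P : MvPolynomial (Fin m) ℝ),
      (∀ i, (Torus.IsSmooth (g i) ∧ Torus.IsDivFree (g i) ∧ Torus.HasZeroMean (g i) ∧
        (∀ k ∉ (Torus.freqBall N).erase (0 : Fin 3 → ℤ), mFourierCoeff (EuclideanSpace.complexify ∘ (g i)) k = 0))) →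
      Integrable (fun u => Torus.nsGeneratorPairing ν f u (fun x => ∑ i : Fin m,
        (MvPolynomial.eval (fun j => Torus.pairing u.1 (g j)) (MvPolynomial.pderiv i P)) • g i x)) μ ∧
      ∫ u, Torus.nsGeneratorPairing ν f u (fun x => ∑ i : Fin m,
        (MvPolynomial.eval (fun j => Torus.pairing u.1 (g j)) (MvPolynomial.pderiv i P)) • g i x) ∂μ = 0) →
    ∀ Φ : Torus.CylindricalTest (Fin 3),
      (∀ i, (∀ k ∉ (Torus.freqBall N).erase (0 : Fin 3 → ℤ), mFourierCoeff (EuclideanSpace.complexify ∘ (Φ.g i)) k = 0)) →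
      Integrable (fun u => Torus.nsGeneratorPairing ν f u (Φ.grad u)) μ ∧
        ∫ u, Torus.nsGeneratorPairing ν f u (Φ.grad u) ∂μ = 0

/-! ### The registered stubs -/

/-- **STUB 1 — weak-* closure in the moment order `d` with polynomial rows of every degree.**
At fixed `(f, ν, N, E, ε, R, κ)`: loud `d`-stationary level-`N` probability measures for every `d`,
supported in `‖u‖ ≤ R`, with `κ`-resolved dissipation, mean energy `≤ E`, dissipation `≥ ε` ⟹ ONE
level-`N` probability measure with the same support ball, tail schedule and budgets that is
`d`-stationary for EVERY `d` simultaneously (every polynomial cylindrical observable in band-limited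
smooth solenoidal mean-zero fields is drift-free, row integrable). Weak-* sequential compactness of
probability measures on the compact carrier `{u level-N, ‖u‖ ≤ R}`; energy, band enstrophies and
polynomial generator rows are continuous there, so every clause is closed in the limit (the `d`-th row
holds for `μ_{d'}` as soon as `d' > deg`). Why plausibly true: it is steps 1–3 of the landed twin
`Theorems.momentClosure_proof`. Size M/L. Sources: FMRT2001 (Ch. IV App. B), doi:10.3934/dcdsb.2019165,
arXiv:1807.08956. -/
theorem stub_polyStationaryLimit :
    ∀ f : UnitAddTorus (Fin 3) → EuclideanSpace ℝ (Fin 3), Torus.IsSmooth f → Torus.IsDivFree f →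
    Torus.HasZeroMean f → ∀ (ν : ℝ) (N : ℕ) (E ε R : ℝ) (κ : ℕ → ℕ), 0 < ν →
    (∀ d : ℕ, ∃ μ : Measure (Torus.energySpace (Fin 3)), IsProbabilityMeasure μ ∧
      (∀ᵐ (u : Torus.energySpace (Fin 3)) ∂μ, (∀ k ∉ (Torus.freqBall N).erase (0 : Fin 3 → ℤ),
        mFourierCoeff (EuclideanSpace.complexify ∘ (u.1 : UnitAddTorus (Fin 3) → EuclideanSpace ℝ (Fin 3))) k = 0)) ∧
      (∀ᵐ u ∂μ, ‖u‖ ≤ R) ∧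
      (∀ n : ℕ, ∫⁻ (u : Torus.energySpace (Fin 3)), Torus.eGradNormSq (u.1 : UnitAddTorus (Fin 3) → EuclideanSpace ℝ (Fin 3)) ∂μ ≤
        (∫⁻ (u : Torus.energySpace (Fin 3)), Torus.eGradNormSq (Torus.fourierTruncate (κ n) (u.1 : UnitAddTorus (Fin 3) → EuclideanSpace ℝ (Fin 3))) ∂μ) +
          ((n : ENNReal) + 1)⁻¹) ∧
      (∀ (m : ℕ) (g : Fin m → UnitAddTorus (Fin 3) → EuclideanSpace ℝ (Fin 3)) (P : MvPolynomial (Fin m) ℝ),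
        (∀ i, (Torus.IsSmooth (g i) ∧ Torus.IsDivFree (g i) ∧ Torus.HasZeroMean (g i) ∧
          (∀ k ∉ (Torus.freqBall N).erase (0 : Fin 3 → ℤ), mFourierCoeff (EuclideanSpace.complexify ∘ (g i)) k = 0))) →
        P.totalDegree + 1 ≤ d →
        Integrable (fun u => Torus.nsGeneratorPairing ν f u (fun x => ∑ i : Fin m,
          (MvPolynomial.eval (fun j => Torus.pairing u.1 (g j)) (MvPolynomial.pderiv i P)) • g i x)) μ ∧
        ∫ u, Torus.nsGeneratorPairing ν f u (fun x => ∑ i : Fin m,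
          (MvPolynomial.eval (fun j => Torus.pairing u.1 (g j)) (MvPolynomial.pderiv i P)) • g i x) ∂μ = 0) ∧
      Torus.ensembleEnergy μ ≤ E ∧ ε ≤ Torus.ensembleDissipation ν μ) →
    ∃ μ : Measure (Torus.energySpace (Fin 3)), IsProbabilityMeasure μ ∧
      (∀ᵐ (u : Torus.energySpace (Fin 3)) ∂μ, (∀ k ∉ (Torus.freqBall N).erase (0 : Fin 3 → ℤ),
        mFourierCoeff (EuclideanSpace.complexify ∘ (u.1 : UnitAddTorus (Fin 3) → EuclideanSpace ℝ (Fin 3))) k = 0)) ∧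
      (∀ᵐ u ∂μ, ‖u‖ ≤ R) ∧
      (∀ n : ℕ, ∫⁻ (u : Torus.energySpace (Fin 3)), Torus.eGradNormSq (u.1 : UnitAddTorus (Fin 3) → EuclideanSpace ℝ (Fin 3)) ∂μ ≤
        (∫⁻ (u : Torus.energySpace (Fin 3)), Torus.eGradNormSq (Torus.fourierTruncate (κ n) (u.1 : UnitAddTorus (Fin 3) → EuclideanSpace ℝ (Fin 3))) ∂μ) +
          ((n : ENNReal) + 1)⁻¹) ∧
      (∀ (m : ℕ) (g : Fin m → UnitAddTorus (Fin 3) → EuclideanSpace ℝ (Fin 3)) (P : MvPolynomial (Fin m) ℝ),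
        (∀ i, (Torus.IsSmooth (g i) ∧ Torus.IsDivFree (g i) ∧ Torus.HasZeroMean (g i) ∧
          (∀ k ∉ (Torus.freqBall N).erase (0 : Fin 3 → ℤ), mFourierCoeff (EuclideanSpace.complexify ∘ (g i)) k = 0))) →
        Integrable (fun u => Torus.nsGeneratorPairing ν f u (fun x => ∑ i : Fin m,
          (MvPolynomial.eval (fun j => Torus.pairing u.1 (g j)) (MvPolynomial.pderiv i P)) • g i x)) μ ∧
        ∫ u, Torus.nsGeneratorPairing ν f u (fun x => ∑ i : Fin m,
          (MvPolynomial.eval (fun j => Torus.pairing u.1 (g j)) (MvPolynomial.pderiv i P)) • g i x) ∂μ = 0) ∧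
      Torus.ensembleEnergy μ ≤ E ∧ ε ≤ Torus.ensembleDissipation ν μ := by
  sorry

/-- **STUB 2 — polynomial stationarity of every degree ⟹ `C¹_c` cylindrical invariance on a level
ball.** For a smooth force `f`, any `ν`, a level `N`, a radius `R` and a level-`N` probability measure
`μ` supported in `‖u‖ ≤ R`: if the Galerkin–NS generator row `∫⟨F(u), ∇p(u)⟩ dμ` vanishes (row
integrable) for EVERY polynomial observable `p((u,g₁),…,(u,gₘ))` in band-limited smooth solenoidal
mean-zero fields `gᵢ`, then `∫⟨F(u), Φ'(u)⟩ dμ = 0` (row integrable) for every compactly supported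
`C¹` cylindrical test functional `Φ` with band-limited fields. `C¹`-Weierstrass on the compact
coordinate image of the carrier (`Literature.Topology.FourManifolds.exists_mvPolynomial_close_C1`) and
`⟨F(u), Φ'(u)⟩ - ⟨F(u), ∇p(u)⟩ = Σᵢ (∂ᵢφ - ∂ᵢp)(coords u) ⟨F(u), gᵢ⟩` with `⟨F(u), gᵢ⟩` bounded on the
carrier. Why plausibly true: it is step 4 (`integral_nsGeneratorPairing_grad_eq_zero`) of the landed
twin proof. Size M. Sources: FMRT2001 (Ch. IV §1.2, Ch. V §1), doi:10.3934/dcdsb.2019165. -/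
theorem stub_cylindricalUpgrade :
    ∀ f : UnitAddTorus (Fin 3) → EuclideanSpace ℝ (Fin 3), Torus.IsSmooth f →
    ∀ (ν : ℝ) (N : ℕ) (R : ℝ) (μ : Measure (Torus.energySpace (Fin 3))), IsProbabilityMeasure μ →
    (∀ᵐ (u : Torus.energySpace (Fin 3)) ∂μ, (∀ k ∉ (Torus.freqBall N).erase (0 : Fin 3 → ℤ),
      mFourierCoeff (EuclideanSpace.complexify ∘ (u.1 : UnitAddTorus (Fin 3) → EuclideanSpace ℝ (Fin 3))) k = 0)) →
    (∀ᵐ u ∂μ, ‖u‖ ≤ R) →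
    (∀ (m : ℕ) (g : Fin m → UnitAddTorus (Fin 3) → EuclideanSpace ℝ (Fin 3)) (P : MvPolynomial (Fin m) ℝ),
      (∀ i, (Torus.IsSmooth (g i) ∧ Torus.IsDivFree (g i) ∧ Torus.HasZeroMean (g i) ∧
        (∀ k ∉ (Torus.freqBall N).erase (0 : Fin 3 → ℤ), mFourierCoeff (EuclideanSpace.complexify ∘ (g i)) k = 0))) →
      Integrable (fun u => Torus.nsGeneratorPairing ν f u (fun x => ∑ i : Fin m,
        (MvPolynomial.eval (fun j => Torus.pairing u.1 (g j)) (MvPolynomial.pderiv i P)) • g i x)) μ ∧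
      ∫ u, Torus.nsGeneratorPairing ν f u (fun x => ∑ i : Fin m,
        (MvPolynomial.eval (fun j => Torus.pairing u.1 (g j)) (MvPolynomial.pderiv i P)) • g i x) ∂μ = 0) →
    ∀ Φ : Torus.CylindricalTest (Fin 3),
      (∀ i, (∀ k ∉ (Torus.freqBall N).erase (0 : Fin 3 → ℤ), mFourierCoeff (EuclideanSpace.complexify ∘ (Φ.g i)) k = 0)) →
      Integrable (fun u => Torus.nsGeneratorPairing ν f u (Φ.grad u)) μ ∧
        ∫ u, Torus.nsGeneratorPairing ν f u (Φ.grad u) ∂μ = 0 := by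
  sorry

/-! ### The composition: the skeleton concludes the crux BY NAME -/

/-- **The crux from the two stubs**, pure logic: STUB 1 yields the level-`N` measure with every clause
of the conclusion except the cylindrical one, carrying instead polynomial stationarity of every degree;
STUB 2 upgrades the latter to cylindrical invariance. -/
theorem MomentClosure_of :
    Sig.stub_polyStationaryLimit → Sig.stub_cylindricalUpgrade →
      Summit.AnomalousDissipation.AnomalousDissipation.Theses.QuarticLadder.MomentClosure := by
  intro hA hB f hfs hfd hfz ν N E ε R κ hν hd
  obtain ⟨μ, hP, hL, hR, hT, hS, hE, hD⟩ := hA f hfs hfd hfz ν N E ε R κ hν hd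
  exact ⟨μ, hP, hL, hR, hT, fun Φ hΦ => hB f hfs ν N R μ hP hL hR hS Φ hΦ, hE, hD⟩

/-- **… with the registered stubs plugged in**: the skeleton proves the crux by name modulo exactly
the two `sorry`s of `stub_polyStationaryLimit` and `stub_cylindricalUpgrade` (their statements ARE
`Sig.stub_*`, checked here by the elaborator). -/
theorem MomentClosure_of_stubs :
    Summit.AnomalousDissipation.AnomalousDissipation.Theses.QuarticLadder.MomentClosure :=
  MomentClosure_of stub_polyStationaryLimit stub_cylindricalUpgrade

end Summit.AnomalousDissipation.AnomalousDissipation.Cruxes.MomentClosure.Birth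

end
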